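import Summits.NavierStokesRegularity.NavierStokesRegularity.Theorems.TypeICertificateLadderTargetStretchingChannelsRung
import Summits.NavierStokesRegularity.NavierStokesRegularity.Theorems.TypeICertificateLadderTargetStretchingLogMeanProduct
import HarnessLib

/-!
# Crux `Target` = `TypeICertificateLadder.NoTypeIBlowup` (stmt-NavierStokesRegularity-1217), line
# `depletion-ladder`: THE VORTICITY-SIDE CHANNELS OF ENSTROPHY PRODUCTION, VII — RATE-FREE form (Type I OR Type II):
# the log-time mean of `(T−t)·L(t)·m(t)²/ν` is at least one at every singular time

`--supports stmt-NavierStokesRegularity-1217` (helper; file 7 of the channel series; consumer of file III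
`longitudinal_along_flow` and of g11's PRODUCT LAW `hasSmoothExtensionPast_of_sqIntegral_depletion_amplitude` /
`exists_sqIntegral_depletion_amplitude_gt_of_not_hasSmoothExtensionPast`). Author: STA lineage `ns-sta-19551-p1` (g12).

Files III/VI are stated under a Type-I rate `C`. The longitudinal channel is a FLOW-WISE DEPLETION COEFFICIENT in the sense of
the product law with `k(t)² = L(t) = (∫‖Dω ω‖²/‖ω‖²)/‖∇ω‖₂²` (file I), so the rate-free log-mean law applies verbatim:

* `longitudinalCoefficient_flowwise` — `|J(t)| ≤ k(t)·M·‖ω‖₂·‖∇ω‖₂` for every bound `|u(t)| ≤ M`, with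
  `k(t) = (∫‖Dω ω‖²/‖ω‖²)^{1/2}/‖∇ω‖₂` (junk-safe: when `‖∇ω‖₂ = 0` both sides vanish).
* `hasSmoothExtensionPast_of_sqIntegral_longitudinal_amplitude` — **RATE-FREE LONGITUDINAL RUNG**: an amplitude majorant
  `m(t) ≥ sup|u(t)|` from an onset `t₁` with `∫_{t₁}^t L·m² ≤ ν(ρ² log((T−t₁)/(T−t)) + B)`, `ρ² < 1` ⇒ smooth extension past `T`.
* `exists_sqIntegral_longitudinal_amplitude_gt_of_not_hasSmoothExtensionPast` — **RATE-FREE PORTRAIT (Type I or II)**: at a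
  singular time, for every onset, every amplitude majorant `m`, every `ρ² < 1` and `B`, some `t ∈ [t₁,T)` has
  `∫_{t₁}^t L(τ) m(τ)² dτ > ν(ρ² log((T−t₁)/(T−t)) + B)`: the product «longitudinal palinstrophy fraction × speed²» has
  log-time mean `≥ ν/(T−t)` — a Type-II blow-up (speed above every `C√(ν/(T−t))`) may straighten its vortex lines
  (`L → 0`) only as fast as its speed² over-runs the self-similar rate. This is the part of the channel analysis that
  bears on the TYPE-II RESIDUE `stub_typeIIResidue` of the crux's skeleton `Lines/nearmax.lean` (no rate assumed).

WHAT THIS IS NOT: conditional criteria; nothing here excludes any blow-up. [folklore]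
-/

noncomputable section

open Set Filter Topology MeasureTheory
open scoped RealInnerProductSpace ENNReal NNReal ContDiff
open Literature.Analysis.FluidPDE

namespace Summit.NavierStokesRegularity.NavierStokesRegularity.Theorems.DepletionLadder

-- the problem directory repeats the summit name (`NavierStokesRegularity/NavierStokesRegularity`)
set_option linter.dupNamespace false

open Summit.NavierStokesRegularity.NavierStokesRegularity.Theorems.RungReynoldsOne

namespace Channels

variable {ν T : ℝ} {u : ℝ → EuclideanSpace ℝ (Fin 3) → EuclideanSpace ℝ (Fin 3)}
  {p : ℝ → EuclideanSpace ℝ (Fin 3) → ℝ}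

/-- **The longitudinal fraction is a flow-wise depletion coefficient.** For a classical Leray–Hopf rapidly-decaying-datum
solution on `[0,T)`, at every `t ∈ [0,T)` and for every bound `|u(t,·)| ≤ M`:
`|∫⟪ω, Du ω⟫| ≤ k(t)·M·‖ω‖₂·‖∇ω‖₂` with `k(t) = (∫‖Dω ω‖²/‖ω‖²)^{1/2} / ‖∇ω‖₂` (`k(t)² = L(t) ≤ 1`; if `‖∇ω‖₂ = 0` then
`∫‖Dω ω‖²/‖ω‖² = 0` too and both sides vanish). [folklore] -/
theorem longitudinalCoefficient_flowwise (hν : 0 < ν) (hT : 0 < T)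
    (hsol : IsClassicalNSSolutionOn (Ico 0 T) ν 0 u p) (hLH : IsLerayHopfOn T ν 0 (u 0) u)
    (hdec : HasRapidSpatialDecay (u 0)) :
    ∀ t ∈ Ico 0 T, ∀ M : ℝ, (∀ x, ‖u t x‖ ≤ M) →
      |∫ x, ⟪curl (u t) x, fderiv ℝ (u t) x (curl (u t) x)⟫| ≤
        (Real.sqrt (∫ x, ‖fderiv ℝ (curl (u t)) x (curl (u t) x)‖ ^ 2 / ‖curl (u t) x‖ ^ 2) /
            Real.sqrt (∫ x, frobeniusNormSq (fderiv ℝ (curl (u t)) x))) * M *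
          Real.sqrt (∫ x, ‖curl (u t) x‖ ^ 2) * Real.sqrt (∫ x, frobeniusNormSq (fderiv ℝ (curl (u t)) x)) := by
  intro t ht M hM
  have hJ := longitudinal_along_flow hν hT hsol hLH hdec t ht M hM
  -- `∫‖Dω ω‖²/‖ω‖² ≤ W` at the slice
  have htt : (t + T) / 2 ∈ Ioo 0 T := ⟨by linarith [ht.1], by linarith [ht.2]⟩
  obtain ⟨q, hsolt, hut, -, -⟩ := stub_taoCover hν hT hsol hLH hdec htt
  have htI : t ∈ Icc 0 ((t + T) / 2) := ⟨ht.1, by linarith [ht.2]⟩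
  obtain ⟨-, iA, -⟩ := slice_integrability hsolt hut htI
  have hv : ContDiff ℝ ∞ (u t) := hsol.contDiff_velocity ht
  obtain ⟨-, hLW⟩ := integral_longitudinalSq_le (v := u t) (hv.of_le (by norm_cast)) iA
  set Lint : ℝ := ∫ x, ‖fderiv ℝ (curl (u t)) x (curl (u t) x)‖ ^ 2 / ‖curl (u t) x‖ ^ 2 with hLdef
  set W : ℝ := ∫ x, frobeniusNormSq (fderiv ℝ (curl (u t)) x) with hWdef
  have hL0 : 0 ≤ Lint := integral_nonneg fun x => by positivity
  by_cases hW : Real.sqrt W = 0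
  · -- then `Lint ≤ W ≤ 0`, so `Lint = 0` and both sides vanish
    have hW0 : W ≤ 0 := by
      by_contra hpos
      exact (Real.sqrt_pos.2 (not_le.1 hpos)).ne' hW
    have hLint0 : Lint = 0 := le_antisymm (hLW.trans hW0) hL0
    have hJ0 : |∫ x, ⟪curl (u t) x, fderiv ℝ (u t) x (curl (u t) x)⟫| ≤ 0 := by
      simpa [hLint0] using hJ
    rw [hW, mul_zero]
    exact hJ0
  · calc |∫ x, ⟪curl (u t) x, fderiv ℝ (u t) x (curl (u t) x)⟫|
        ≤ M * Real.sqrt (∫ x, ‖curl (u t) x‖ ^ 2) * Real.sqrt Lint := hJ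
      _ = Real.sqrt Lint / Real.sqrt W * M * Real.sqrt (∫ x, ‖curl (u t) x‖ ^ 2) * Real.sqrt W := by
          field_simp

/-- **RATE-FREE LONGITUDINAL RUNG (product form).** A classical Leray–Hopf rapidly-decaying-datum solution on `[0,T)` with
an amplitude majorant `m` (`‖u(t,x)‖ ≤ m(t)` for `t ∈ [t₁,T)`) such that `(k·m)²` is locally interval integrable and
`∫_{t₁}^t (k m)² ≤ ν(ρ² log((T−t₁)/(T−t)) + B)` with `ρ² < 1`, where `k(t) = (∫‖Dω ω‖²/‖ω‖²)^{1/2}/‖∇ω‖₂` is the square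
root of the longitudinal palinstrophy fraction, extends smoothly past `T` — no rate hypothesis. [folklore] -/
theorem hasSmoothExtensionPast_of_sqIntegral_longitudinal_amplitude {ρ t₁ B : ℝ} (hν : 0 < ν) (hT : 0 < T)
    (hρ : ρ ^ 2 < 1) (ht₁ : t₁ ∈ Ico 0 T)
    (hsol : IsClassicalNSSolutionOn (Ico 0 T) ν 0 u p) (hLH : IsLerayHopfOn T ν 0 (u 0) u)
    (hdec : HasRapidSpatialDecay (u 0))
    {m : ℝ → ℝ} (hamp : ∀ t ∈ Ico t₁ T, ∀ x, ‖u t x‖ ≤ m t)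
    (hii : ∀ t ∈ Ico t₁ T, IntervalIntegrable (fun τ =>
      ((Real.sqrt (∫ x, ‖fderiv ℝ (curl (u τ)) x (curl (u τ) x)‖ ^ 2 / ‖curl (u τ) x‖ ^ 2) /
          Real.sqrt (∫ x, frobeniusNormSq (fderiv ℝ (curl (u τ)) x))) * m τ) ^ 2) volume t₁ t)
    (hint : ∀ t ∈ Ico t₁ T, ∫ τ in t₁..t,
      ((Real.sqrt (∫ x, ‖fderiv ℝ (curl (u τ)) x (curl (u τ) x)‖ ^ 2 / ‖curl (u τ) x‖ ^ 2) /
          Real.sqrt (∫ x, frobeniusNormSq (fderiv ℝ (curl (u τ)) x))) * m τ) ^ 2 ≤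
        ν * (ρ ^ 2 * Real.log ((T - t₁) / (T - t)) + B)) :
    HasSmoothExtensionPast ν 0 u T :=
  hasSmoothExtensionPast_of_sqIntegral_depletion_amplitude hν hT hρ ht₁ hsol hLH hdec
    (fun t ht M hM => longitudinalCoefficient_flowwise hν hT hsol hLH hdec t ⟨ht₁.1.trans ht.1, ht.2⟩ M hM)
    hamp hii hint

/-- **RATE-FREE PORTRAIT (Type I or Type II).** At a singular time of a classical Leray–Hopf rapidly-decaying-datum
solution, for every onset `t₁`, every amplitude majorant `m` of the speed on `[t₁,T)` (with `(k m)²` locally interval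
integrable), every `ρ² < 1` and every `B`, some `t ∈ [t₁,T)` has
`∫_{t₁}^t k(τ)² m(τ)² dτ > ν(ρ² log((T−t₁)/(T−t)) + B)`, `k² = L` the longitudinal palinstrophy fraction: the log-time mean
of `(T−τ)·L(τ)·m(τ)²/ν` is at least one. [folklore] -/
theorem exists_sqIntegral_longitudinal_amplitude_gt_of_not_hasSmoothExtensionPast {ρ t₁ B : ℝ} (hν : 0 < ν)
    (hT : 0 < T) (hρ : ρ ^ 2 < 1) (ht₁ : t₁ ∈ Ico 0 T)
    (hsol : IsClassicalNSSolutionOn (Ico 0 T) ν 0 u p) (hLH : IsLerayHopfOn T ν 0 (u 0) u)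
    (hdec : HasRapidSpatialDecay (u 0)) (hsing : ¬ HasSmoothExtensionPast ν 0 u T)
    {m : ℝ → ℝ} (hamp : ∀ t ∈ Ico t₁ T, ∀ x, ‖u t x‖ ≤ m t)
    (hii : ∀ t ∈ Ico t₁ T, IntervalIntegrable (fun τ =>
      ((Real.sqrt (∫ x, ‖fderiv ℝ (curl (u τ)) x (curl (u τ) x)‖ ^ 2 / ‖curl (u τ) x‖ ^ 2) /
          Real.sqrt (∫ x, frobeniusNormSq (fderiv ℝ (curl (u τ)) x))) * m τ) ^ 2) volume t₁ t) :
    ∃ t ∈ Ico t₁ T, ν * (ρ ^ 2 * Real.log ((T - t₁) / (T - t)) + B) <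
      ∫ τ in t₁..t,
        ((Real.sqrt (∫ x, ‖fderiv ℝ (curl (u τ)) x (curl (u τ) x)‖ ^ 2 / ‖curl (u τ) x‖ ^ 2) /
            Real.sqrt (∫ x, frobeniusNormSq (fderiv ℝ (curl (u τ)) x))) * m τ) ^ 2 :=
  exists_sqIntegral_depletion_amplitude_gt_of_not_hasSmoothExtensionPast hν hT hρ ht₁ hsol hLH hdec hsing
    (fun t ht M hM => longitudinalCoefficient_flowwise hν hT hsol hLH hdec t ⟨ht₁.1.trans ht.1, ht.2⟩ M hM)
    hamp hii

end Channels

end Summit.NavierStokesRegularity.NavierStokesRegularity.Theorems.DepletionLadder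

end
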